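import Literature.IUT.HodgeTheaters.DiscreteProfiniteConjugatesSurfaceLemma27
import Literature.IUT.HodgeTheaters.SurfaceGroupLemma27
import HarnessLib

/-!
# [IUTchI] Thm 2.6 / Cor 2.8 / Lem 2.7 (vi)(vii) AS TYPED, modulo exactly the classical facts
# [Stb2] and Riemann–Hurwitz

Mochizuki, *Inter-universal Teichmüller theory I*, kurims manuscript (May 2020), §2, Theorem 2.6 p. 56,
Lemma 2.7 p. 57, Corollary 2.8 p. 59 [cite: Mochizuki2012, Thm 2.6 pp.56-59] (D-0012 claim key; series
status DISPUTED — classical group theory here; Remark 2.8.1: the surface case is off the IUT route).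

Final assembly.  `DiscreteProfiniteConjugatesSurfaceLemma27.lean` (abc-iut-L5-d2) derives the four
named statements from the named statements of Lemma 2.7 (i), (iii), (iv) plus the two classical named
facts; abc-iut-L5-d1's `FreeOrSurface.twoGeneratedSubgroupFree_holds`, `rankTwoInAbelianization_holds`,
`abelianSubgroupCyclic_holds` (`SurfaceGroupLemma27.lean`, `SurfaceGroupLemma27iv.lean`: Baumslag's
residual freeness of surface groups with big powers, and the amalgam `S_{g+1} ≅ F_{2g} *_ℤ F_2`) prove
Lemma 2.7 (i), (iii), (iv) AS TYPED unconditionally.  RESULT: `ProfiniteConjugatesOfDiscreteSubgroups`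
(Thm 2.6), `SubgroupsOfComplexHyperbolicPi1` (Cor 2.8), `FreeOrSurface.centralizerCommutatorKernelTrivial`
(Lem 2.7 (vi)), `FreeOrSurface.autFixingCommutatorKernelTrivial` (Lem 2.7 (vii)) hold GIVEN EXACTLY the
two classical named facts `SurfaceGroupConjugacySeparable` ([Stb2] = Stebe 1972 Thm 3.3, the input cited
on [IUTchI] p. 57) and `SurfaceGroupFiniteIndexSubgroup` (Riemann–Hurwitz, ZVC 1980 Thm 4.14.22 /
Prop 4.14.23) — `def … : Prop`, NOT proved in the tree (CONDITIONAL results; typed ≠ discharged).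
Lemma 2.7 (v) is not used.  Proof-only file; nothing restated.
-/

namespace Literature.IUT.HodgeTheaters

open Literature.GroupTheory.CombinatorialGroupTheory (SurfaceGroupConjugacySeparable
  SurfaceGroupFiniteIndexSubgroup)

universe u

namespace FreeOrSurface

/-- **[IUTchI] Theorem 2.6 AS TYPED** (`ProfiniteConjugatesOfDiscreteSubgroups`), GIVEN the named facts
[Stb2] (`SurfaceGroupConjugacySeparable`) and Riemann–Hurwitz (`SurfaceGroupFiniteIndexSubgroup`); every
other input is a theorem of the tree. [cite: Mochizuki2012, Thm 2.6 pp.56-57] -/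
theorem profiniteConjugatesOfDiscreteSubgroups_of_facts (hCS : SurfaceGroupConjugacySeparable)
    (hFI : SurfaceGroupFiniteIndexSubgroup) : ProfiniteConjugatesOfDiscreteSubgroups.{u} :=
  profiniteConjugatesOfDiscreteSubgroups_of_lemma27 hCS hFI twoGeneratedSubgroupFree_holds
    rankTwoInAbelianization_holds abelianSubgroupCyclic_holds

/-- **[IUTchI] Corollary 2.8 AS TYPED** (`SubgroupsOfComplexHyperbolicPi1`), GIVEN the same two named
facts. [cite: Mochizuki2012, Cor 2.8 p.59] -/
theorem subgroupsOfComplexHyperbolicPi1_of_facts (hCS : SurfaceGroupConjugacySeparable)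
    (hFI : SurfaceGroupFiniteIndexSubgroup) : SubgroupsOfComplexHyperbolicPi1.{u} :=
  subgroupsOfComplexHyperbolicPi1_of_lemma27 hCS hFI twoGeneratedSubgroupFree_holds
    rankTwoInAbelianization_holds abelianSubgroupCyclic_holds

/-- **[IUTchI] Lemma 2.7 (vi) AS TYPED** (`FreeOrSurface.centralizerCommutatorKernelTrivial`), GIVEN the
two named facts. [cite: Mochizuki2012, Lem 2.7(vi) pp.58-59] -/
theorem centralizerCommutatorKernelTrivial_of_facts (hCS : SurfaceGroupConjugacySeparable)
    (hFI : SurfaceGroupFiniteIndexSubgroup) : centralizerCommutatorKernelTrivial.{u} :=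
  centralizerCommutatorKernelTrivial_of_lemma27 hCS hFI twoGeneratedSubgroupFree_holds
    rankTwoInAbelianization_holds abelianSubgroupCyclic_holds

/-- **[IUTchI] Lemma 2.7 (vii) AS TYPED** (`FreeOrSurface.autFixingCommutatorKernelTrivial`), GIVEN the
two named facts. [cite: Mochizuki2012, Lem 2.7(vii) p.59] -/
theorem autFixingCommutatorKernelTrivial_of_facts (hCS : SurfaceGroupConjugacySeparable)
    (hFI : SurfaceGroupFiniteIndexSubgroup) : autFixingCommutatorKernelTrivial.{u} :=
  autFixingCommutatorKernelTrivial_of_lemma27 hCS hFI twoGeneratedSubgroupFree_holds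
    rankTwoInAbelianization_holds abelianSubgroupCyclic_holds

end FreeOrSurface

end Literature.IUT.HodgeTheaters
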